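import Mathlib
import Literature.NumberTheory.EllipticCurves.KatoDivisibilityAllPrimes
import Literature.NumberTheory.EllipticCurves.Greenberg1999.RankZeroEulerCharacteristicAnyPrime
import Literature.NumberTheory.EllipticCurves.ModularCurve
import Literature.NumberTheory.EllipticCurves.LeadingTerm
import HarnessLib

/-!
# OrdPublishedInputsAtTwo

Topic `Literature/Uncategorized`. Named literature fact(s) relocated by the gate from `Summits/BirchSwinnertonDyer/BirchSwinnertonDyer/Theorems/ByReductionTypeAtTwoOrdHalvesDefs.lean`
(accept-time relocation of `[cite]`d propositions written inline in a Summits proposal; human ruling 2026-08-15).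
Sources: GreenbergLNM1716, Kato2004Asterisque.

* `Literature.Uncategorized.OrdConversePublishedInputsAtTwo`
* `Literature.Uncategorized.OrdPublishedInputsAtTwo`
-/

namespace Literature.Uncategorized

/-- [support] The four PUBLISHED inputs of the class «non-CM, analytic rank 0, good ordinary at 2» as ONE
conjunction of Literature named facts: modularity (BCDT), Gross–Zagier–Kolyvagin, Kato 2004 Thm. 17.4
(1)(2) at `p = 2`, Greenberg 1999 Thm. 4.1 parity-free. (= children-S1 `OrdPublishedInputsAtTwo`.)
[cite: Kato2004Asterisque, Thm. 17.4 (1)(2) (p. 273)] [cite: GreenbergLNM1716, Thm. 4.1 (p. 102)] -/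
def OrdPublishedInputsAtTwo : Prop :=
  Literature.NumberTheory.EllipticCurves.ModularForms.nonempty_modularParametrizationData ∧
  Literature.NumberTheory.EllipticCurves.rank_eq_analyticRank_of_analyticRank_le_one ∧
  (∀ (W : WeierstrassCurve ℚ) [W.IsElliptic] [W.IsGloballyMinimal] [NeZero (W.conductorNorm ℤ)]
    (f : CuspForm (CongruenceSubgroup.Gamma0 (W.conductorNorm ℤ)) 2),
    Literature.NumberTheory.EllipticCurves.kato_divisibility_allPrimes W 2 (f := f)) ∧
  Literature.NumberTheory.EllipticCurves.Greenberg1999.thm41_charValue_rankZero_anyPrime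

/-- [support] The three PUBLISHED inputs of the rank-0 2-converse at a good ordinary 2 (modularity;
Kato 17.4 (1)(2) at 2; Greenberg Thm. 4.1 parity-free). (= children-S2 `OrdConversePublishedInputsAtTwo`.)
[cite: Kato2004Asterisque, Thm. 17.4 (1)(2) (p. 273)] [cite: GreenbergLNM1716, Thm. 4.1 (p. 102)] -/
def OrdConversePublishedInputsAtTwo : Prop :=
  Literature.NumberTheory.EllipticCurves.ModularForms.nonempty_modularParametrizationData ∧
  (∀ (W : WeierstrassCurve ℚ) [W.IsElliptic] [W.IsGloballyMinimal] [NeZero (W.conductorNorm ℤ)]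
    (f : CuspForm (CongruenceSubgroup.Gamma0 (W.conductorNorm ℤ)) 2),
    Literature.NumberTheory.EllipticCurves.kato_divisibility_allPrimes W 2 (f := f)) ∧
  Literature.NumberTheory.EllipticCurves.Greenberg1999.thm41_charValue_rankZero_anyPrime

end Literature.Uncategorized
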